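import Mathlib.SetTheory.Cardinal.Finite
import Literature.AnabelianGeometry.SemiGraphs.SemiGraph

/-!
# Proper morphisms of semi-graphs lift abutting branches ([SemiAnbd] §1 p. 11, §2 p. 23)

Mochizuki, *Semi-graphs of anabelioids*, Publ. RIMS **42** (2006), §1 p. 11 (a morphism of
semi-graphs "maps `e ⥲ e'` injectively [hence bijectively]" and is compatible with the verticial
restrictions of the coincidence maps) and §2 p. 23 ("lies over a proper morphism of semi-graphs",
i.e. verticial cardinalities are preserved) [cite: MochizukiSemiAnbd2006, §1 p.11].  Consequence
used by every analysis of a finite étale covering `𝒢' → 𝒢` edge by edge (dictionary facts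
(D2), (D3), (D8) of `FiniteEtaleCoveringDictionary.lean`): over a PROPER morphism `φ`, every
abutting branch of `φ(e')` is the image of a (unique) branch of `e'` — the restriction of `φ` to the
verticial portion of `e'` is a bijection onto that of `φ(e')` (`branchMap_verticialPortion_bijective`,
`exists_branch_preimage`).  Proof-only (pure combinatorics of semi-graphs).
-/

namespace Literature.AnabelianGeometry.SemiGraphs

namespace SemiGraph

open CategoryTheory

universe u

variable {G' G : SemiGraph.{u}} (φ : G' ⟶ G)

/-- The branches of an edge form a finite set (an edge has exactly two branches).
[cite: MochizukiSemiAnbd2006, §1 p.11] -/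
theorem finite_setOf_edgeOf_eq (G : SemiGraph.{u}) (e : G.Edge) : {b : G.Branch | G.edgeOf b = e}.Finite := by
  obtain ⟨b₁, b₂, -, -, -, hall⟩ := G.two_branches e
  exact (Set.toFinite {b₁, b₂}).subset fun b hb => by
    rcases hall b hb with rfl | rfl
    · exact Set.mem_insert _ _
    · exact Set.mem_insert_of_mem _ rfl

/-- The verticial portion of an edge is finite. [cite: MochizukiSemiAnbd2006, §1 p.11] -/
theorem finite_verticialPortion (G : SemiGraph.{u}) (e : G.Edge) : (G.verticialPortion e).Finite :=
  (G.finite_setOf_edgeOf_eq e).subset fun _ hb => hb.1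

/-- A morphism of semi-graphs maps the verticial portion of `e'` into that of `φ(e')`.
[cite: MochizukiSemiAnbd2006, §1 p.11] -/
theorem branchMap_mem_verticialPortion {e' : G'.Edge} {b' : G'.Branch}
    (hb' : b' ∈ G'.verticialPortion e') : φ.branchMap b' ∈ G.verticialPortion (φ.edgeMap e') := by
  obtain ⟨he, hs⟩ := hb'
  refine ⟨by rw [φ.edgeOf_branchMap, he], ?_⟩
  obtain ⟨v', hv'⟩ := Option.isSome_iff_exists.mp hs
  rw [φ.abuts_branchMap b' v' hv']
  rfl

/-- **Over a proper morphism, `φ : (verticial portion of e') → (verticial portion of φ e')` is a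
bijection** (injective by the definition of a morphism of semi-graphs, between finite sets of the
same cardinality by properness). [cite: MochizukiSemiAnbd2006, §1 p.11] -/
theorem branchMap_verticialPortion_bijective (hφ : IsProper φ) (e' : G'.Edge) :
    Function.Bijective (fun b' : G'.verticialPortion e' =>
      (⟨φ.branchMap b'.1, branchMap_mem_verticialPortion φ b'.2⟩ :
        G.verticialPortion (φ.edgeMap e'))) := by
  haveI : Finite (G.verticialPortion (φ.edgeMap e')) := (G.finite_verticialPortion _).to_subtype
  refine Function.Injective.bijective_of_nat_card_le (fun b₁ b₂ h => ?_) (le_of_eq ?_)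
  · exact Subtype.ext (φ.branchMap_injOn _ _ (b₁.2.1.trans b₂.2.1.symm) (congrArg Subtype.val h))
  · exact hφ e'

/-- **Branch lifting over a proper morphism**: every branch of `φ(e')` abutting to a vertex is the
image of a branch of `e'`. [cite: MochizukiSemiAnbd2006, §1 p.11] -/
theorem exists_branch_preimage (hφ : IsProper φ) (e' : G'.Edge) (b : G.Branch)
    (hb : G.edgeOf b = φ.edgeMap e') (hbv : (G.abuts b).isSome) :
    ∃ b' : G'.Branch, G'.edgeOf b' = e' ∧ φ.branchMap b' = b := by
  obtain ⟨⟨b', hb'⟩, h⟩ := (branchMap_verticialPortion_bijective φ hφ e').2 ⟨b, hb, hbv⟩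
  exact ⟨b', hb'.1, congrArg Subtype.val h⟩

/-- … and the lift abuts to a vertex over the vertex of `b`. [cite: MochizukiSemiAnbd2006, §1 p.11] -/
theorem exists_branch_preimage_abuts (hφ : IsProper φ) (e' : G'.Edge) (b : G.Branch)
    (hb : G.edgeOf b = φ.edgeMap e') (v : G.Vertex) (hv : G.abuts b = some v) :
    ∃ (b' : G'.Branch) (v' : G'.Vertex), G'.edgeOf b' = e' ∧ φ.branchMap b' = b ∧
      G'.abuts b' = some v' ∧ φ.vertexMap v' = v := by
  obtain ⟨⟨b'', hb''⟩, h⟩ := (branchMap_verticialPortion_bijective φ hφ e').2 ⟨b, hb, by rw [hv]; rfl⟩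
  have hbb : φ.branchMap b'' = b := congrArg Subtype.val h
  obtain ⟨v', hv'⟩ := Option.isSome_iff_exists.mp hb''.2
  refine ⟨b'', v', hb''.1, hbb, hv', ?_⟩
  have := φ.abuts_branchMap b'' v' hv'
  rw [hbb, hv] at this
  exact (Option.some_injective _ this).symm

end SemiGraph

end Literature.AnabelianGeometry.SemiGraphs
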